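import Mathlib
import Literature.Analysis.FluidPDE.ClassicalSolution
import Literature.Analysis.FluidPDE.LerayHopf
import Literature.Analysis.FluidPDE.TaoLocalisation
import Literature.Analysis.FluidPDE.SpaceTimeCalculus
import Literature.Analysis.FluidPDE.RieszPressureSpaceTimeLp
import Literature.Analysis.FluidPDE.SereginSverakPressureLocalTypeI
import Summits.NavierStokesRegularity.NavierStokesRegularity.Theses.L3TimeExponentPincer
import Summits.NavierStokesRegularity.NavierStokesRegularity.Theorems.L3TimeExponentPincerEffNode
import Summits.NavierStokesRegularity.NavierStokesRegularity.Theorems.L3TimeExponentPincerPaceDichotomy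
import Summits.NavierStokesRegularity.NavierStokesRegularity.Theorems.L3TimeExponentPincerFullMorreyMostTimes
import Summits.NavierStokesRegularity.NavierStokesRegularity.Theorems.L3TimeExponentPincerMorreyTypeIDissipationPace
import HarnessLib.Audit
import HarnessLib

/-!
# `K₃(1)` at MOST late times on stub 2's own class (Morrey-Type-I near `T`): the `L³`-fast set is log-null —
# crux `EffSatBlowup`, line `pace` (route `L3TimeExponentPincer`, item `stmt-NavierStokesRegularity-19139`)

Support file (seat ns-pincer-19139-p1, lead of line `pace`; `--supports stmt-NavierStokesRegularity-19139
--as helper`).  nsreg-p4 g5 proved (`L3TimeExponentPincerFullMorreyMostTimes`, p441596) that on the FULL-Morrey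
(scaled-energy Type-I) class the `L³`-fast set `{t : ‖u(t)‖₃³ > A/√(T-t)}` is log-null for every `A` and the crux
clause holds off it.  Here the same is obtained on the LARGER class of stub 2 itself, `MorreyTypeINear u T`
(Barker–Prange (1.7): Morrey bound only on top windows `r > √(T-t)`), for every threshold `A ≥ A₀(M, E₀)`,
from the one-scale slice inequality of `L3TimeExponentPincerMorreyTypeIDissipationPace.l3Slice_of_morreyTypeINear`:

* §1 `sliceBound_le_of_dissipation_le` — the arithmetic: a dissipation bound `∫|∇u(t)|² ≤ D₀/(T-t)` turns the
  slice bound into `A(D₀)/√(T-t)`, `A(D₀) = C₀ (2M)^{1/2} E₀^{1/4} (D₀ + E₀/4)^{3/4}`.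
* §2 `dissipationFast_of_l3Fast_of_morreyTypeINear` — **on stub 2's class, `L³`-fast times are
  dissipation-fast**: with `A₀ = A(1) + 1`, at every late time with `‖u(t)‖₃³ > A/√(T-t)`, `A ≥ A₀`, one has
  `∫|∇u(t)|² ≥ 1/(T-t)` (twice Leray's self-similar dissipation exponent).
* §3 `lintegral_fast_inv_sub_lt_top_of_morreyTypeINear` — hence the fast set is LOG-NULL on a final window,
  `∫ 1_{fast} dt/(T-t) ≤ ∫∫ |∇u|² < ∞`, for every `A ≥ A₀`;
  `effSat_mostTimes_of_morreyTypeINear` — on the blow-up branch: log-null + density zero at `T` + the crux clause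
  `FatClauseAt m R₀ 1 u T t` at every late time off the fast set (landed stub 1 via `fatClauseAt_offFast_of_blowup`).

Placement (honest): stub 2 (`MorreyTypeINear ⇒ L3Slow`) asks that the fast set be EMPTY near `T` for SOME `A`; this
file shows it is log-null (hence of density `0` at `T`) for every large `A`, on stub 2's exact class — the gap
«log-null ∀A ≥ A₀ → empty ∃A» is what remains (nsreg-p4 g5 named the same gap on the smaller full-Morrey class).

WHAT THIS IS NOT: not a claim about Navier–Stokes regularity or blow-up; kernel-checked consequences of the
one-scale interpolation inequality and the energy inequality in the route's frame, landed `--supports`; the crux and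
stubs 2–3 of line `pace` stay open.

References: L. Caffarelli, R. Kohn, L. Nirenberg, CPAM 35 (1982), §2 [CaffarelliKohnNirenberg1982]; T. Barker,
C. Prange, ARMA 236 (2020) = arXiv:1812.09115, (1.7) [BarkerPrange2020]; J. Leray, Acta Math. 63 (1934) [Leray1934].
-/

noncomputable section

open MeasureTheory Set Function Filter Metric Topology TopologicalSpace
open scoped ENNReal NNReal Topology
open Literature.Analysis.FluidPDE
open Summit.NavierStokesRegularity.NavierStokesRegularity.Theorems.L3TimeExponentPincerEffNode
open Summit.NavierStokesRegularity.NavierStokesRegularity.Theorems.L3TimeExponentPincerPaceDichotomy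
open Summit.NavierStokesRegularity.NavierStokesRegularity.Theorems.L3TimeExponentPincerFullMorreyMostTimes
open Summit.NavierStokesRegularity.NavierStokesRegularity.Theorems.L3TimeExponentPincerMorreyTypeIDissipationPace

namespace Summit.NavierStokesRegularity.NavierStokesRegularity.Theorems.L3TimeExponentPincerMorreyTypeIMostTimes

variable {ν T : ℝ} {u : ℝ → EuclideanSpace ℝ (Fin 3) → EuclideanSpace ℝ (Fin 3)}
  {p : ℝ → EuclideanSpace ℝ (Fin 3) → ℝ}

/-! ## §1  Arithmetic: the slice bound under a dissipation bound -/

/-- **The slice bound under a dissipation bound.**  If `Dv ≤ D₀/q²` then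
`C₀ (M·2q)^{1/2} E₀^{1/4} (Dv + (2q)⁻² E₀)^{3/4} ≤ (C₀ (2M)^{1/2} E₀^{1/4} (D₀ + E₀/4)^{3/4}) / q`
(`q = √(T-t)`; `scaling_real_identity`). [folklore] -/
theorem sliceBound_le_of_dissipation_le {C₀ : ℝ≥0} {M E₀ D₀ q : ℝ} (hM : 0 ≤ M) (hE₀ : 0 ≤ E₀) (hD₀ : 0 ≤ D₀)
    (hq : 0 < q) {Dv : ℝ≥0∞} (hDv : Dv ≤ ENNReal.ofReal (D₀ / q ^ 2)) :
    (C₀ : ℝ≥0∞) * ENNReal.ofReal (M * (2 * q)) ^ (1 / 2 : ℝ) * ENNReal.ofReal E₀ ^ (1 / 4 : ℝ) *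
        (Dv + (ENNReal.ofReal ((2 * q) ^ 2))⁻¹ * ENNReal.ofReal E₀) ^ (3 / 4 : ℝ) ≤
      ENNReal.ofReal ((C₀ : ℝ) * ((2 * M) ^ (1 / 2 : ℝ) * E₀ ^ (1 / 4 : ℝ) * (D₀ + E₀ / 4) ^ (3 / 4 : ℝ)) / q) := by
  set K : ℝ := D₀ + E₀ / 4 with hK
  have hK0 : 0 ≤ K := by rw [hK]; positivity
  have h4 : Dv + (ENNReal.ofReal ((2 * q) ^ 2))⁻¹ * ENNReal.ofReal E₀ ≤ ENNReal.ofReal (K / q ^ 2) := by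
    have e1 : (2 * q) ^ 2 = 4 * q ^ 2 := by ring
    rw [e1, ← ENNReal.ofReal_inv_of_pos (by positivity), ← ENNReal.ofReal_mul (by positivity)]
    calc Dv + ENNReal.ofReal ((4 * q ^ 2)⁻¹ * E₀)
        ≤ ENNReal.ofReal (D₀ / q ^ 2) + ENNReal.ofReal ((4 * q ^ 2)⁻¹ * E₀) := by gcongr
      _ = ENNReal.ofReal (K / q ^ 2) := by
          rw [← ENNReal.ofReal_add (by positivity) (by positivity), hK]
          congr 1
          field_simp
  have eM : ENNReal.ofReal (M * (2 * q)) ^ (1 / 2 : ℝ) = ENNReal.ofReal ((M * (2 * q)) ^ (1 / 2 : ℝ)) :=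
    ENNReal.ofReal_rpow_of_nonneg (by positivity) (by norm_num)
  have eE : ENNReal.ofReal E₀ ^ (1 / 4 : ℝ) = ENNReal.ofReal (E₀ ^ (1 / 4 : ℝ)) :=
    ENNReal.ofReal_rpow_of_nonneg hE₀ (by norm_num)
  have eK : ENNReal.ofReal (K / q ^ 2) ^ (3 / 4 : ℝ) = ENNReal.ofReal ((K / q ^ 2) ^ (3 / 4 : ℝ)) :=
    ENNReal.ofReal_rpow_of_nonneg (by positivity) (by norm_num)
  have hx1 : 0 ≤ (C₀ : ℝ) := NNReal.coe_nonneg C₀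
  have hx2 : 0 ≤ (C₀ : ℝ) * (M * (2 * q)) ^ (1 / 2 : ℝ) := by positivity
  have hx3 : 0 ≤ (C₀ : ℝ) * (M * (2 * q)) ^ (1 / 2 : ℝ) * E₀ ^ (1 / 4 : ℝ) := by positivity
  calc (C₀ : ℝ≥0∞) * ENNReal.ofReal (M * (2 * q)) ^ (1 / 2 : ℝ) * ENNReal.ofReal E₀ ^ (1 / 4 : ℝ) *
        (Dv + (ENNReal.ofReal ((2 * q) ^ 2))⁻¹ * ENNReal.ofReal E₀) ^ (3 / 4 : ℝ)
      ≤ (C₀ : ℝ≥0∞) * ENNReal.ofReal (M * (2 * q)) ^ (1 / 2 : ℝ) * ENNReal.ofReal E₀ ^ (1 / 4 : ℝ) *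
          (ENNReal.ofReal (K / q ^ 2)) ^ (3 / 4 : ℝ) :=
        mul_le_mul' le_rfl (ENNReal.rpow_le_rpow h4 (by norm_num))
    _ = ENNReal.ofReal ((C₀ : ℝ) * (M * (2 * q)) ^ (1 / 2 : ℝ) * E₀ ^ (1 / 4 : ℝ) * (K / q ^ 2) ^ (3 / 4 : ℝ)) := by
        rw [eM, eE, eK, ← ENNReal.ofReal_coe_nnreal, ← ENNReal.ofReal_mul hx1, ← ENNReal.ofReal_mul hx2,
          ← ENNReal.ofReal_mul hx3]
    _ = ENNReal.ofReal ((C₀ : ℝ) * ((2 * M) ^ (1 / 2 : ℝ) * E₀ ^ (1 / 4 : ℝ) * K ^ (3 / 4 : ℝ)) / q) := by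
        rw [mul_div_assoc, ← scaling_real_identity (E := E₀) hM hK0 hq]
        congr 1
        ring

/-! ## §2  On stub 2's class, `L³`-fast times are dissipation-fast -/

/-- **`L³`-fast ⇒ dissipation ≥ `1/(T-t)` on the Morrey-Type-I class.**  For a classical solution on `[0,T)`,
Leray–Hopf on `[0,T)`, with `MorreyTypeINear u T`, there are `A₀ > 0` and `T₁ ∈ (0,T)` such that for every
`A ≥ A₀` and every `t ∈ (T₁,T)` with `‖u(t)‖₃³ > A/√(T-t)` the dissipation satisfies `∫|∇u(t)|² ≥ (T-t)⁻¹`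
(contrapositive of `sliceBound_le_of_dissipation_le` with `D₀ = 1`; `A₀ = C₀ (2M)^{1/2} E₀^{1/4} (1 + E₀/4)^{3/4} + 1`).
[cite: CaffarelliKohnNirenberg1982, §2 (2.8)–(2.10)] -/
theorem dissipationFast_of_l3Fast_of_morreyTypeINear (hν : 0 < ν) (hT : 0 < T)
    (hsol : IsClassicalNSSolutionOn (Ico 0 T) ν 0 u p) (hLH : IsLerayHopfOn T ν 0 (u 0) u)
    (hMor : MorreyTypeINear u T) :
    ∃ A₀ : ℝ, 0 < A₀ ∧ ∃ T₁ ∈ Ioo 0 T, ∀ A : ℝ, A₀ ≤ A → ∀ t ∈ Ioo T₁ T,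
      ENNReal.ofReal (A / Real.sqrt (T - t)) < eLpNorm (u t) 3 volume ^ (3 : ℝ) →
        ENNReal.ofReal ((T - t)⁻¹) ≤ ∫⁻ x, ENNReal.ofReal (frobeniusNormSq (fderiv ℝ (u t) x)) := by
  obtain ⟨C₀, M, hM, T₁, hT₁, hslice⟩ := l3Slice_of_morreyTypeINear hν hT hsol hLH hMor
  set E₀ : ℝ := 2 * VectorCalculus.kineticEnergy (u 0) with hE₀
  have hE₀ : 0 ≤ E₀ := mul_nonneg zero_le_two (Literature.Analysis.FluidPDE.kineticEnergy_nonneg _)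
  set A₁ : ℝ := (C₀ : ℝ) * ((2 * M) ^ (1 / 2 : ℝ) * E₀ ^ (1 / 4 : ℝ) * (1 + E₀ / 4) ^ (3 / 4 : ℝ)) with hA₁
  have hA₁ : 0 ≤ A₁ := by rw [hA₁]; positivity
  refine ⟨A₁ + 1, by positivity, max T₁ (T / 2), ⟨lt_max_of_lt_right (by linarith), max_lt hT₁ (by linarith)⟩,
    fun A hA t ht hfast => ?_⟩
  have ht₁ : t ∈ Ioo T₁ T := ⟨lt_of_le_of_lt (le_max_left _ _) ht.1, ht.2⟩
  set s : ℝ := T - t with hs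
  have hspos : 0 < s := by rw [hs]; linarith [ht.2]
  set q : ℝ := Real.sqrt s with hq
  have hqpos : 0 < q := Real.sqrt_pos.2 hspos
  have hq2 : q ^ 2 = s := Real.sq_sqrt hspos.le
  by_contra hcon
  rw [not_le] at hcon
  -- the dissipation bound with `D₀ = 1`
  have hDv : ∫⁻ x, ENNReal.ofReal (frobeniusNormSq (fderiv ℝ (u t) x)) ≤ ENNReal.ofReal (1 / q ^ 2) := by
    rw [hq2, one_div]; exact hcon.le
  have h1 := hslice t ht₁
  rw [← hq] at h1
  have h2 := sliceBound_le_of_dissipation_le (C₀ := C₀) hM.le hE₀ zero_le_one hqpos hDv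
  have h3 : eLpNorm (u t) 3 volume ^ (3 : ℝ) = ∫⁻ x, ‖u t x‖ₑ ^ (3 : ℕ) := by
    rw [← lintegral_enorm_rpow_three_eq_eLpNorm_rpow]
    refine lintegral_congr fun x => ?_
    rw [← ENNReal.rpow_natCast]
    norm_num
  have h4 : ENNReal.ofReal (A₁ / q) ≤ ENNReal.ofReal (A / q) :=
    ENNReal.ofReal_le_ofReal (div_le_div_of_nonneg_right (by linarith) hqpos.le)
  have key : eLpNorm (u t) 3 volume ^ (3 : ℝ) < eLpNorm (u t) 3 volume ^ (3 : ℝ) :=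
    calc eLpNorm (u t) 3 volume ^ (3 : ℝ) = ∫⁻ x, ‖u t x‖ₑ ^ (3 : ℕ) := h3
      _ ≤ _ := h1
      _ ≤ ENNReal.ofReal (A₁ / q) := h2
      _ ≤ ENNReal.ofReal (A / q) := h4
      _ < eLpNorm (u t) 3 volume ^ (3 : ℝ) := hfast
  exact lt_irrefl _ key

/-! ## §3  Log-nullity of the fast set and the clause at most times, on stub 2's class -/

/-- **Time-iterated dissipation is finite** for a classical solution on `[0,T)` that is Leray–Hopf on `[0,T)`:
`∫₀ᵀ ∫|∇u(t)|² dt < ∞` (the classical gradient; Tonelli with `lintegral_slab_frobeniusNormSq_fderiv_lt_top'`).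
[cite: Leray1934, (2.17)] -/
theorem lintegral_Ioo_dissipation_lt_top (hsol : IsClassicalNSSolutionOn (Ico 0 T) ν 0 u p)
    (hLH : IsLerayHopfOn T ν 0 (u 0) u) :
    ∫⁻ t in Ioo 0 T, ∫⁻ x, ENNReal.ofReal (frobeniusNormSq (fderiv ℝ (u t) x)) < ⊤ := by
  set g : ℝ × EuclideanSpace ℝ (Fin 3) → ℝ≥0∞ :=
    fun z => ENNReal.ofReal (frobeniusNormSq (fderiv ℝ (u z.1) z.2)) with hg
  have hcont : ContinuousOn g (Ioo 0 T ×ˢ (univ : Set (EuclideanSpace ℝ (Fin 3)))) := by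
    have h1 : ContinuousOn (fun z : ℝ × EuclideanSpace ℝ (Fin 3) => fderiv ℝ (u z.1) z.2)
        (Ioo 0 T ×ˢ (univ : Set (EuclideanSpace ℝ (Fin 3)))) :=
      (hsol.smooth_velocity.continuousOn_fderiv_slice (uniqueDiffOn_Ico 0 T)).mono
        (prod_mono Ioo_subset_Ico_self Subset.rfl)
    exact (ENNReal.continuous_ofReal.comp continuous_frobeniusNormSq').comp_continuousOn h1
  have hprod : ((volume : Measure ℝ).restrict (Ioo 0 T)).prod
      (volume : Measure (EuclideanSpace ℝ (Fin 3))) =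
      (volume : Measure (ℝ × EuclideanSpace ℝ (Fin 3))).restrict (Ioo 0 T ×ˢ univ) := by
    rw [Measure.restrict_prod_eq_prod_univ, ← Measure.volume_eq_prod]
  have hgm : AEMeasurable (uncurry fun t x => g (t, x))
      (((volume : Measure ℝ).restrict (Ioo 0 T)).prod (volume : Measure (EuclideanSpace ℝ (Fin 3)))) := by
    rw [hprod]
    exact hcont.aemeasurable (measurableSet_Ioo.prod MeasurableSet.univ)
  have htonelli : ∫⁻ t in Ioo 0 T, ∫⁻ x, g (t, x) =
      ∫⁻ z in Ioo 0 T ×ˢ (univ : Set (EuclideanSpace ℝ (Fin 3))), g z := by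
    rw [lintegral_lintegral hgm, hprod]
  have hfin : ∫⁻ z in Ioo 0 T ×ˢ (univ : Set (EuclideanSpace ℝ (Fin 3))), g z < ⊤ :=
    SereginSverak2002.lintegral_slab_frobeniusNormSq_fderiv_lt_top' hsol hLH
  change ∫⁻ t in Ioo 0 T, ∫⁻ x, g (t, x) < ⊤
  rw [htonelli]
  exact hfin

/-- **The `L³`-fast set of a Morrey-Type-I frame solution is LOG-NULL** for every large threshold: with `A₀`, `T₁`
of `dissipationFast_of_l3Fast_of_morreyTypeINear`, for every `A ≥ A₀`,
`∫_{(T₁,T)} 1_{‖u(t)‖₃³ > A/√(T-t)} dt/(T-t) ≤ ∫₀ᵀ∫|∇u|² < ∞`. [cite: CaffarelliKohnNirenberg1982, §2 (2.8)–(2.10)] -/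
theorem lintegral_fast_inv_sub_lt_top_of_morreyTypeINear (hν : 0 < ν) (hT : 0 < T)
    (hsol : IsClassicalNSSolutionOn (Ico 0 T) ν 0 u p) (hLH : IsLerayHopfOn T ν 0 (u 0) u)
    (hMor : MorreyTypeINear u T) :
    ∃ A₀ : ℝ, 0 < A₀ ∧ ∃ T₁ ∈ Ioo 0 T, ∀ A : ℝ, A₀ ≤ A →
      ∫⁻ t in Ioo T₁ T, {t | ENNReal.ofReal (A / Real.sqrt (T - t)) < eLpNorm (u t) 3 volume ^ (3 : ℝ)}.indicator
          (fun t => ENNReal.ofReal ((T - t)⁻¹)) t < ⊤ := by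
  obtain ⟨A₀, hA₀, T₁, hT₁, hfast⟩ := dissipationFast_of_l3Fast_of_morreyTypeINear hν hT hsol hLH hMor
  refine ⟨A₀, hA₀, T₁, hT₁, fun A hA => ?_⟩
  have hpt : ∀ t ∈ Ioo T₁ T,
      {t | ENNReal.ofReal (A / Real.sqrt (T - t)) < eLpNorm (u t) 3 volume ^ (3 : ℝ)}.indicator
          (fun t => ENNReal.ofReal ((T - t)⁻¹)) t ≤
        ∫⁻ x, ENNReal.ofReal (frobeniusNormSq (fderiv ℝ (u t) x)) := by
    intro t ht
    by_cases hf : t ∈ {t | ENNReal.ofReal (A / Real.sqrt (T - t)) < eLpNorm (u t) 3 volume ^ (3 : ℝ)}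
    · rw [indicator_of_mem hf]
      exact hfast A hA t ht hf
    · rw [indicator_of_notMem hf]
      exact bot_le
  calc ∫⁻ t in Ioo T₁ T, {t | ENNReal.ofReal (A / Real.sqrt (T - t)) < eLpNorm (u t) 3 volume ^ (3 : ℝ)}.indicator
          (fun t => ENNReal.ofReal ((T - t)⁻¹)) t
      ≤ ∫⁻ t in Ioo T₁ T, ∫⁻ x, ENNReal.ofReal (frobeniusNormSq (fderiv ℝ (u t) x)) :=
        setLIntegral_mono' measurableSet_Ioo hpt
    _ ≤ ∫⁻ t in Ioo 0 T, ∫⁻ x, ENNReal.ofReal (frobeniusNormSq (fderiv ℝ (u t) x)) :=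
        lintegral_mono_set (Ioo_subset_Ioo_left hT₁.1.le)
    _ < ⊤ := lintegral_Ioo_dissipation_lt_top hsol hLH

/-- **`K₃(1)` at MOST late times on stub 2's class (Morrey-Type-I near `T`).**  A frame blow-up (classical on
`[0,T)`, Leray–Hopf from a rapidly decaying datum, no smooth extension past `T`) of the class `MorreyTypeINear u T`
has a threshold `A₀ > 0` such that for every `A ≥ A₀` there are `m, R₀ > 0` and `T₁ ∈ (0,T)` with:
(i) the `L³`-fast set `F = {t : ‖u(t)‖₃³ > A/√(T-t)}` is log-null on `(T₁,T)`; (ii) `F` has density zero at `T`;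
(iii) the clause `FatClauseAt m R₀ 1 u T t` of `EffSatBlowup` holds at every `t ∈ (T₁,T) ∖ F`.
Stub 2 (`L3Slow`) would make `F` EMPTY near `T` for some `A`. [cite: CaffarelliKohnNirenberg1982, §2 (2.8)–(2.10)] -/
theorem effSat_mostTimes_of_morreyTypeINear (hν : 0 < ν) (hT : 0 < T)
    (hsol : IsClassicalNSSolutionOn (Ico 0 T) ν 0 u p) (hLH : IsLerayHopfOn T ν 0 (u 0) u)
    (hdec : HasRapidSpatialDecay (u 0)) (hnext : ¬ HasSmoothExtensionPast ν 0 u T)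
    (hMor : MorreyTypeINear u T) :
    ∃ A₀ : ℝ, 0 < A₀ ∧ ∀ A : ℝ, A₀ ≤ A →
      ∃ m : ℝ, 0 < m ∧ ∃ R₀ : ℝ, 0 < R₀ ∧ ∃ T₁ ∈ Ioo 0 T,
        (∫⁻ t in Ioo T₁ T, {t | ENNReal.ofReal (A / Real.sqrt (T - t)) < eLpNorm (u t) 3 volume ^ (3 : ℝ)}.indicator
            (fun t => ENNReal.ofReal ((T - t)⁻¹)) t < ⊤) ∧
        (∀ ε : ℝ, 0 < ε → ∃ h₀ : ℝ, 0 < h₀ ∧ ∀ h : ℝ, 0 < h → h < h₀ →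
          volume ({t | ENNReal.ofReal (A / Real.sqrt (T - t)) < eLpNorm (u t) 3 volume ^ (3 : ℝ)} ∩ Ioo (T - h) T)
            ≤ ENNReal.ofReal (ε * h)) ∧
        ∀ t ∈ Ioo T₁ T,
          t ∉ {t | ENNReal.ofReal (A / Real.sqrt (T - t)) < eLpNorm (u t) 3 volume ^ (3 : ℝ)} →
            FatClauseAt m R₀ 1 u T t := by
  obtain ⟨A₀, hA₀, T₂, hT₂, hlog⟩ := lintegral_fast_inv_sub_lt_top_of_morreyTypeINear hν hT hsol hLH hMor
  refine ⟨A₀, hA₀, fun A hA => ?_⟩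
  have hApos : 0 < A := lt_of_lt_of_le hA₀ hA
  have hint := hlog A hA
  obtain ⟨m, hm, R₀, hR₀, T₁, hT₁, hcl'⟩ := fatClauseAt_offFast_of_blowup hν hT hsol hLH hdec hnext hApos
  have hdens := density_zero_of_lintegral_indicator_inv_sub_lt_top hT₂.2
    (nullMeasurableSet_fast_of_frame hsol hT₂.1.le A) hint
  set T₃ : ℝ := max T₁ T₂ with hT₃
  have hT₃mem : T₃ ∈ Ioo 0 T := ⟨lt_max_of_lt_right hT₂.1, max_lt hT₁ hT₂.2⟩
  refine ⟨m, hm, R₀, hR₀, T₃, hT₃mem, ?_, hdens, fun t ht hnf => ?_⟩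
  · exact lt_of_le_of_lt (lintegral_mono_set (Ioo_subset_Ioo_left (le_max_right _ _))) hint
  · have ht1 : t ∈ Ioo T₁ T := ⟨lt_of_le_of_lt (le_max_left _ _) ht.1, ht.2⟩
    exact hcl' t ht1 (not_lt.1 hnf)

/-! ## §4  Pointwise in time: the clause at every dissipation-slow late time (appended) -/

/-- **On stub 2's class the crux clause `K₃(1)` holds at EVERY late time at which the enstrophy is below
`(T-t)⁻¹`.**  For a frame blow-up of the class `MorreyTypeINear u T` there are `m, R₀ > 0` and `T₁ ∈ (0,T)` such
that at every `t ∈ (T₁,T)` with `∫|∇u(t)|² < (T-t)⁻¹` one has `FatClauseAt m R₀ 1 u T t`: a dissipation-slow time is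
not `L³`-fast for the threshold `A₀` (`dissipationFast_of_l3Fast_of_morreyTypeINear`), hence `L³`-slow there, and
the slow slice of the landed stub 1 applies (`fatClauseAt_offFast_of_blowup`).  The exceptional set of
`effSat_mostTimes_of_morreyTypeINear` is thus contained in the explicit dissipation-fast set
`{t : ∫|∇u(t)|² ≥ (T-t)⁻¹}`, log-null by the energy inequality alone. [cite: CaffarelliKohnNirenberg1982, §2 (2.8)–(2.10)] -/
theorem fatClauseAt_of_dissipationSlow_of_morreyTypeINear (hν : 0 < ν) (hT : 0 < T)
    (hsol : IsClassicalNSSolutionOn (Ico 0 T) ν 0 u p) (hLH : IsLerayHopfOn T ν 0 (u 0) u)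
    (hdec : HasRapidSpatialDecay (u 0)) (hnext : ¬ HasSmoothExtensionPast ν 0 u T)
    (hMor : MorreyTypeINear u T) :
    ∃ m : ℝ, 0 < m ∧ ∃ R₀ : ℝ, 0 < R₀ ∧ ∃ T₁ ∈ Ioo 0 T, ∀ t ∈ Ioo T₁ T,
      (∫⁻ x, ENNReal.ofReal (frobeniusNormSq (fderiv ℝ (u t) x))) < ENNReal.ofReal ((T - t)⁻¹) →
        FatClauseAt m R₀ 1 u T t := by
  obtain ⟨A₀, hA₀, T₂, hT₂, hfast⟩ := dissipationFast_of_l3Fast_of_morreyTypeINear hν hT hsol hLH hMor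
  obtain ⟨m, hm, R₀, hR₀, T₁, hT₁, hcl'⟩ := fatClauseAt_offFast_of_blowup hν hT hsol hLH hdec hnext hA₀
  refine ⟨m, hm, R₀, hR₀, max T₁ T₂, ⟨lt_max_of_lt_right hT₂.1, max_lt hT₁ hT₂.2⟩, fun t ht hslowD => ?_⟩
  have ht1 : t ∈ Ioo T₁ T := ⟨lt_of_le_of_lt (le_max_left _ _) ht.1, ht.2⟩
  have ht2 : t ∈ Ioo T₂ T := ⟨lt_of_le_of_lt (le_max_right _ _) ht.1, ht.2⟩
  -- not `L³`-fast at the threshold `A₀` (else dissipation-fast, contradicting `hslowD`)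
  have hnotfast : ¬ ENNReal.ofReal (A₀ / Real.sqrt (T - t)) < eLpNorm (u t) 3 volume ^ (3 : ℝ) :=
    fun hf => absurd (hfast A₀ le_rfl t ht2 hf) (not_le.2 hslowD)
  exact hcl' t ht1 (not_lt.1 hnotfast)

/-- The same in «most times» form with the EXPLICIT exceptional set: for a frame blow-up of stub 2's class, the
dissipation-fast set `{t ∈ (T₁,T) : ∫|∇u(t)|² ≥ (T-t)⁻¹}` is log-null (`∫ 1 dt/(T-t) ≤ ∫∫|∇u|² < ∞`) and the crux
clause holds at every other late time. [cite: Leray1934, (2.17)] -/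
theorem effSat_off_dissipationFast_of_morreyTypeINear (hν : 0 < ν) (hT : 0 < T)
    (hsol : IsClassicalNSSolutionOn (Ico 0 T) ν 0 u p) (hLH : IsLerayHopfOn T ν 0 (u 0) u)
    (hdec : HasRapidSpatialDecay (u 0)) (hnext : ¬ HasSmoothExtensionPast ν 0 u T)
    (hMor : MorreyTypeINear u T) :
    ∃ m : ℝ, 0 < m ∧ ∃ R₀ : ℝ, 0 < R₀ ∧ ∃ T₁ ∈ Ioo 0 T,
      (∫⁻ t in Ioo T₁ T,
          {t | ENNReal.ofReal ((T - t)⁻¹) ≤ ∫⁻ x, ENNReal.ofReal (frobeniusNormSq (fderiv ℝ (u t) x))}.indicator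
            (fun t => ENNReal.ofReal ((T - t)⁻¹)) t < ⊤) ∧
      ∀ t ∈ Ioo T₁ T,
        t ∉ {t | ENNReal.ofReal ((T - t)⁻¹) ≤ ∫⁻ x, ENNReal.ofReal (frobeniusNormSq (fderiv ℝ (u t) x))} →
          FatClauseAt m R₀ 1 u T t := by
  obtain ⟨m, hm, R₀, hR₀, T₁, hT₁, hcl'⟩ :=
    fatClauseAt_of_dissipationSlow_of_morreyTypeINear hν hT hsol hLH hdec hnext hMor
  refine ⟨m, hm, R₀, hR₀, T₁, hT₁, ?_, fun t ht hnD => hcl' t ht (not_le.1 hnD)⟩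
  have hpt : ∀ t ∈ Ioo T₁ T,
      {t | ENNReal.ofReal ((T - t)⁻¹) ≤ ∫⁻ x, ENNReal.ofReal (frobeniusNormSq (fderiv ℝ (u t) x))}.indicator
          (fun t => ENNReal.ofReal ((T - t)⁻¹)) t ≤
        ∫⁻ x, ENNReal.ofReal (frobeniusNormSq (fderiv ℝ (u t) x)) := by
    intro t _ht
    by_cases hf : t ∈ {t | ENNReal.ofReal ((T - t)⁻¹) ≤ ∫⁻ x, ENNReal.ofReal (frobeniusNormSq (fderiv ℝ (u t) x))}
    · rw [indicator_of_mem hf]; exact hf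
    · rw [indicator_of_notMem hf]; exact bot_le
  calc ∫⁻ t in Ioo T₁ T,
        {t | ENNReal.ofReal ((T - t)⁻¹) ≤ ∫⁻ x, ENNReal.ofReal (frobeniusNormSq (fderiv ℝ (u t) x))}.indicator
          (fun t => ENNReal.ofReal ((T - t)⁻¹)) t
      ≤ ∫⁻ t in Ioo T₁ T, ∫⁻ x, ENNReal.ofReal (frobeniusNormSq (fderiv ℝ (u t) x)) :=
        setLIntegral_mono' measurableSet_Ioo hpt
    _ ≤ ∫⁻ t in Ioo 0 T, ∫⁻ x, ENNReal.ofReal (frobeniusNormSq (fderiv ℝ (u t) x)) :=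
        lintegral_mono_set (Ioo_subset_Ioo_left hT₁.1.le)
    _ < ⊤ := lintegral_Ioo_dissipation_lt_top hsol hLH

end Summit.NavierStokesRegularity.NavierStokesRegularity.Theorems.L3TimeExponentPincerMorreyTypeIMostTimes

end
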